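import Mathlib
import Summits.NavierStokesRegularity.OSWSelfSimilar.SheetHalfLineVelocityKernel
import HarnessLib

/-!
# The half-line log kernel `log((x+y)/|x−y|)` as a series of squares:
# `∬ Ω(x)Ω(y) log((x+y)/|x−y|) = Σ_{k≥0} (2/(2k+1)) ∬ Ω(x)Ω(y) q^{2k+1}`, `∬ Ω(x)Ω(y) qⁿ = ∫₀^∞ 2nτ^{2n−1} L_n(τ)² dτ`

HONEST FRAMING (cell ns-blowup GROUP B «PROFILE SEARCH», zone Z3 = the 1-D viscous gCLM/OSW sheet; human rulings
D-0035/D-0074): **classical real-variable potential theory (the logarithmic kernel folded onto `(0,∞)` for odd = neutral charges),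
kernel-checked as the engine of the SIGN-FREE velocity–vorticity pairing law `∫₀^∞𝒰Ω ≤ 0`
(`SheetHalfLineVelocityPairing`) and of the tail-sign law on the NS-type line (`SheetNSLineTailSign`); 1-D MODEL; not Euler,
not Navier–Stokes; «violates: none — MODEL».**

OBJECT. `Ω : ℝ → ℝ` continuous with the NS-type-line envelope `|Ω(y)| ≤ C/(1+y²)`; `q = q(x,y) = min(x,y)/max(x,y) ∈ [0,1]`
on `(0,∞)²`; `L_n(τ) = ∫_τ^∞ Ω(y) y^{−n} dy`. Measure on `(0,∞)²`: product of the restricted Lebesgue measures.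

WHAT IS PROVED (everything absolutely convergent; no Fourier analysis, no principal values; no definitions; all [folklore]):
* `hasSum_logKernel` — for `x, y > 0`, `x ≠ y`: `log((x+y)/|x−y|) = log((1+q)/(1−q)) = Σ_{k≥0} (2/(2k+1)) q^{2k+1}`
  (`Real.hasSum_log_sub_log_of_abs_lt_one`);
* `pow_ratio_eq_integral` — EVERY TERM IS A SQUARE: `q^{n+1} = (∫₀^{min(x,y)} 2(n+1)τ^{2n+1} dτ)·(xy)^{−(n+1)}` (`min·max = xy`);
* `integral_prod_mul_pow_ratio_eq` — **`∬ Ω(x)Ω(y) q^{n+1} d(x,y) = ∫₀^∞ 2(n+1)τ^{2n+1} L_{n+1}(τ)·L_{n+1}(τ) dτ`**, and the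
  right-hand integrand is integrable on `(0,∞)` (Fubini on `(0,∞)² × (0,∞)`, dominated by `|Ω(x)||Ω(y)|`);
* `integrable_prod_mul_logKernel` — `Ω(x)Ω(y) log((x+y)/|x−y|) ∈ L¹((0,∞)²)` (sections + the uniform bound
  `∫₀^∞|Ω(y)| log((x+y)/|x−y|) dy ≤ log 5·‖Ω‖₁ + (1+log 5)C` of `SheetHalfLineVelocityKernel`);
* `hasSum_integral_prod_logKernel` — **`HasSum (k ↦ ∬ (2/(2k+1)) Ω(x)Ω(y) q^{2k+1}) (∬ Ω(x)Ω(y) log((x+y)/|x−y|))`**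
  (dominated convergence for the series, majorant `|Ω(x)||Ω(y)| log((x+y)/|x−y|)`).
PRECEDENT IN THE TREE: positivity of the logarithmic energy of a neutral COMPACTLY SUPPORTED bounded density,
`Literature.Analysis.Potential.integral_sq_div_sq_le_neg_logEnergy` (Saff–Totik Lemma I.1.8; Vershik–Kerov 1985); here the
charge has `ξ⁻²` tails and the folded kernel `log((x+y)/|x−y|)` is bounded off the diagonal, so no truncation is needed.
bears_on: LADDER-NS N5 / zone Z3 clause (i′) (CENSUS-Z3 v2.11 §0, §3 [g11] pen remark) → N1 linear core. WHAT THIS IS NOT: not NS.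
-/

noncomputable section
open Set Filter Topology MeasureTheory
open scoped Real

namespace Summit.NavierStokesRegularity.OSWSelfSimilar
namespace SheetHalfLine
open Literature.Analysis.Fourier

/-! ### The kernel as a series of odd powers of `q = min/max` -/

/-- For `0 < x`, `0 < y`: `0 ≤ min(x,y)/max(x,y) ≤ 1`. [folklore] -/
theorem ratio_mem_Icc {x y : ℝ} (hx : 0 < x) (hy : 0 < y) : min x y / max x y ∈ Icc (0:ℝ) 1 := by
  have hm : 0 < max x y := lt_max_of_lt_left hx
  exact ⟨div_nonneg (le_min hx.le hy.le) hm.le, (div_le_one hm).mpr (min_le_max)⟩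

/-- For `0 < x`, `0 < y`, `x ≠ y`: `min(x,y)/max(x,y) < 1`. [folklore] -/
theorem ratio_lt_one {x y : ℝ} (hx : 0 < x) (hne : x ≠ y) : min x y / max x y < 1 := by
  have hm : 0 < max x y := lt_max_of_lt_left hx
  rw [div_lt_one hm]
  exact min_lt_max.mpr hne

/-- **`log((x+y)/|x−y|) = Σ_{k≥0} (2/(2k+1)) q^{2k+1}`, `q = min(x,y)/max(x,y)`**, for `x, y > 0`, `x ≠ y`
(`= log((1+q)/(1−q)) = 2 artanh q`). [folklore] -/
theorem hasSum_logKernel {x y : ℝ} (hx : 0 < x) (hy : 0 < y) (hne : x ≠ y) :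
    HasSum (fun k : ℕ => (2:ℝ) * (1 / (2 * k + 1)) * (min x y / max x y) ^ (2 * k + 1))
      (Real.log ((x + y) / |x - y|)) := by
  set q := min x y / max x y with hq
  have hq1 : q < 1 := ratio_lt_one hx hne
  have hq0 : 0 ≤ q := (ratio_mem_Icc hx hy).1
  have habs : |q| < 1 := by rw [abs_of_nonneg hq0]; exact hq1
  have h := Real.hasSum_log_sub_log_of_abs_lt_one habs
  have hM : 0 < max x y := lt_max_of_lt_left hx
  have hkey : Real.log (1 + q) - Real.log (1 - q) = Real.log ((x + y) / |x - y|) := by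
    rw [← Real.log_div (by linarith) (by linarith)]
    congr 1
    have e1 : 1 + q = (max x y + min x y) / max x y := by rw [hq]; field_simp
    have e2 : 1 - q = (max x y - min x y) / max x y := by rw [hq]; field_simp
    rw [e1, e2, div_div_div_cancel_right₀ hM.ne']
    rcases le_total x y with hxy | hxy
    · rw [max_eq_right hxy, min_eq_left hxy, abs_of_nonpos (by linarith : x - y ≤ 0), neg_sub, add_comm]
    · rw [max_eq_left hxy, min_eq_right hxy, abs_of_nonneg (by linarith : 0 ≤ x - y)]
  rwa [hkey] at h

/-! ### Every term is a square: `qⁿ = 2n∫₀^{min} τ^{2n−1} dτ/(xy)ⁿ` -/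

/-- `∫₀^m 2(n+1) τ^{2n+1} dτ = m^{2n+2}` (`m ≥ 0`), as a set integral over `Ioo 0 m`. [folklore] -/
theorem integral_Ioo_pow_odd {m : ℝ} (hm : 0 ≤ m) (n : ℕ) :
    ∫ τ in Ioo 0 m, (2 * n + 2 : ℝ) * τ ^ (2 * n + 1) = m ^ (2 * n + 2) := by
  rw [← integral_Ioc_eq_integral_Ioo, ← intervalIntegral.integral_of_le hm, intervalIntegral.integral_const_mul,
    integral_pow]
  have h : ((2 * n + 1 : ℕ) : ℝ) + 1 = 2 * n + 2 := by push_cast; ring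
  rw [h, zero_pow (by omega), sub_zero, mul_div_cancel₀ _ (by positivity)]

/-- **`(min(x,y)/max(x,y))^{n+1} = (∫₀^{min(x,y)} 2(n+1)τ^{2n+1} dτ)·((xy)^{n+1})⁻¹`** for `x, y > 0`. [folklore] -/
theorem pow_ratio_eq_integral {x y : ℝ} (hx : 0 < x) (hy : 0 < y) (n : ℕ) :
    (min x y / max x y) ^ (n + 1)
      = (∫ τ in Ioo 0 (min x y), (2 * n + 2 : ℝ) * τ ^ (2 * n + 1)) * ((x * y) ^ (n + 1))⁻¹ := by
  have hm : 0 < min x y := lt_min hx hy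
  have hM : 0 < max x y := lt_max_of_lt_left hx
  rw [integral_Ioo_pow_odd hm.le, ← min_mul_max x y]
  have e : min x y / max x y = min x y ^ 2 * (min x y * max x y)⁻¹ := by
    field_simp
  rw [e, mul_pow, ← pow_mul, inv_pow, show 2 * (n + 1) = 2 * n + 2 by ring]

/-! ### `∬ Ω(x)Ω(y) qⁿ = ∫₀^∞ 2nτ^{2n−1} L_n(τ)² dτ` (Fubini on `(0,∞)² × (0,∞)`) -/

/-- A.e. on `(0,∞)²` (product of the restricted Lebesgue measures) both coordinates are positive. [folklore] -/
theorem ae_prod_Ioi_pos :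
    ∀ᵐ p ∂((volume.restrict (Ioi (0:ℝ))).prod (volume.restrict (Ioi (0:ℝ)))), 0 < p.1 ∧ 0 < p.2 := by
  have hpr : (volume.restrict (Ioi (0:ℝ))).prod (volume.restrict (Ioi (0:ℝ)))
      = (volume.prod volume).restrict (Ioi (0:ℝ) ×ˢ Ioi (0:ℝ)) := Measure.prod_restrict _ _
  rw [hpr]
  filter_upwards [ae_restrict_mem (measurableSet_Ioi.prod measurableSet_Ioi)] with p hp
  exact ⟨hp.1, hp.2⟩

/-- `|Ω(x)Ω(y)|·w` is integrable on `(0,∞)²` whenever `Ω ∈ L¹` and the measurable weight satisfies `0 ≤ w ≤ 1` a.e.;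
used with `w = q^{n}`. [folklore] -/
theorem integrable_prod_abs_mul_abs_mul {Om : ℝ → ℝ} (hΩi : Integrable Om) {w : ℝ × ℝ → ℝ} (hw : Measurable w)
    (hw01 : ∀ᵐ p ∂((volume.restrict (Ioi (0:ℝ))).prod (volume.restrict (Ioi (0:ℝ)))), 0 ≤ w p ∧ w p ≤ 1) :
    Integrable (fun p : ℝ × ℝ => |Om p.1| * |Om p.2| * w p)
      ((volume.restrict (Ioi (0:ℝ))).prod (volume.restrict (Ioi (0:ℝ)))) := by
  have hΩm : AEStronglyMeasurable Om volume := hΩi.aestronglyMeasurable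
  have h2 : Integrable (fun p : ℝ × ℝ => |Om p.1| * |Om p.2|)
      ((volume.restrict (Ioi (0:ℝ))).prod (volume.restrict (Ioi (0:ℝ)))) :=
    (hΩi.abs.restrict (s := Ioi 0)).mul_prod (hΩi.abs.restrict (s := Ioi 0))
  refine Integrable.mono' h2 (h2.aestronglyMeasurable.mul hw.aestronglyMeasurable) ?_
  filter_upwards [hw01] with p hp
  rw [Real.norm_eq_abs, abs_mul, abs_of_nonneg hp.1, abs_of_nonneg (mul_nonneg (abs_nonneg _) (abs_nonneg _))]
  exact mul_le_of_le_one_right (mul_nonneg (abs_nonneg _) (abs_nonneg _)) hp.2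

/-- **EVERY TERM IS A SQUARE: `∬_{(0,∞)²} Ω(x)Ω(y) q^{n+1} d(x,y) = ∫₀^∞ 2(n+1)τ^{2n+1}·L(τ)·L(τ) dτ`**,
`q = min(x,y)/max(x,y)`, `L(τ) = ∫_τ^∞ Ω(y)(y^{n+1})⁻¹ dy`, for continuous `Ω` with `|Ω(y)| ≤ C/(1+y²)`
(`q^{n+1} = 2(n+1)∫₀^∞ 𝟙_{τ<x}𝟙_{τ<y} τ^{2n+1}dτ·(xy)^{−(n+1)}`; Fubini, dominated by `|Ω(x)||Ω(y)|`). [folklore] -/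
theorem integral_prod_mul_pow_ratio_eq {Om : ℝ → ℝ} {C : ℝ} (hc : Continuous Om)
    (hC : ∀ y, |Om y| ≤ C / (1 + y ^ 2)) (n : ℕ) :
    IntegrableOn (fun τ => ((2 * n + 2 : ℝ) * τ ^ (2 * n + 1))
          * ((∫ y in Ioi τ, Om y * (y ^ (n + 1))⁻¹) * (∫ y in Ioi τ, Om y * (y ^ (n + 1))⁻¹))) (Ioi 0) ∧
    ∫ p, Om p.1 * Om p.2 * (min p.1 p.2 / max p.1 p.2) ^ (n + 1)
        ∂((volume.restrict (Ioi (0:ℝ))).prod (volume.restrict (Ioi (0:ℝ))))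
      = ∫ τ in Ioi (0:ℝ), ((2 * n + 2 : ℝ) * τ ^ (2 * n + 1))
          * ((∫ y in Ioi τ, Om y * (y ^ (n + 1))⁻¹) * (∫ y in Ioi τ, Om y * (y ^ (n + 1))⁻¹)) := by
  set μ : Measure ℝ := volume.restrict (Ioi (0:ℝ)) with hμ
  have hΩm : Measurable Om := hc.measurable
  have hΩi : Integrable Om := integrable_of_env hc hC
  have hquad : ∀ᵐ p ∂ μ.prod μ, 0 < p.1 ∧ 0 < p.2 := ae_prod_Ioi_pos
  -- the triple integrand
  set E : Set ((ℝ × ℝ) × ℝ) := {q | q.2 < q.1.1 ∧ q.2 < q.1.2} with hE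
  have hEm : MeasurableSet E :=
    (measurableSet_lt measurable_snd (measurable_fst.comp measurable_fst)).inter
      (measurableSet_lt measurable_snd (measurable_snd.comp measurable_fst))
  set G : (ℝ × ℝ) × ℝ → ℝ := E.indicator
    (fun q => Om q.1.1 * Om q.1.2 * ((q.1.1 * q.1.2) ^ (n + 1))⁻¹ * ((2 * n + 2 : ℝ) * q.2 ^ (2 * n + 1))) with hG
  have hGm : Measurable G := by
    refine Measurable.indicator ?_ hEm
    exact (((hΩm.comp (measurable_fst.comp measurable_fst)).mul (hΩm.comp (measurable_snd.comp measurable_fst))).mul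
      (((measurable_fst.comp measurable_fst).mul (measurable_snd.comp measurable_fst)).pow_const _).inv).mul
      (measurable_const.mul (measurable_snd.pow_const _))
  set Ψ : ℝ × ℝ → ℝ → ℝ := fun p τ => G (p, τ) with hΨ
  have hunc : Function.uncurry Ψ = G := by funext q; rfl
  -- τ-sections
  have hsecτ : ∀ p : ℝ × ℝ, ∀ τ, Ψ p τ = (Iio (min p.1 p.2)).indicator
      (fun τ => Om p.1 * Om p.2 * ((p.1 * p.2) ^ (n + 1))⁻¹ * ((2 * n + 2 : ℝ) * τ ^ (2 * n + 1))) τ := by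
    intro p τ
    simp only [hΨ, hG, Set.indicator_apply, hE, mem_setOf_eq, mem_Iio, lt_min_iff]
  have hvalτ : ∀ p : ℝ × ℝ, 0 < p.1 → 0 < p.2 →
      ∫ τ, Ψ p τ ∂μ = Om p.1 * Om p.2 * (min p.1 p.2 / max p.1 p.2) ^ (n + 1) := by
    intro p hx hy
    simp_rw [hsecτ p]
    rw [hμ, setIntegral_indicator measurableSet_Iio, Ioi_inter_Iio, integral_const_mul, pow_ratio_eq_integral hx hy n]
    ring
  have hnormτ : ∀ p : ℝ × ℝ, 0 < p.1 → 0 < p.2 →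
      ∫ τ, ‖Ψ p τ‖ ∂μ = |Om p.1| * |Om p.2| * (min p.1 p.2 / max p.1 p.2) ^ (n + 1) := by
    intro p hx hy
    simp_rw [hsecτ p, norm_indicator_eq_indicator_norm]
    rw [hμ, setIntegral_indicator measurableSet_Iio, Ioi_inter_Iio]
    have hxy : 0 < (p.1 * p.2) ^ (n + 1) := by positivity
    have e : ∀ τ ∈ Ioo 0 (min p.1 p.2),
        ‖Om p.1 * Om p.2 * ((p.1 * p.2) ^ (n + 1))⁻¹ * ((2 * n + 2 : ℝ) * τ ^ (2 * n + 1))‖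
          = |Om p.1| * |Om p.2| * ((p.1 * p.2) ^ (n + 1))⁻¹ * ((2 * n + 2 : ℝ) * τ ^ (2 * n + 1)) := by
      intro τ hτ
      have hτ0 : 0 < τ := hτ.1
      rw [Real.norm_eq_abs, abs_mul, abs_mul, abs_mul, abs_of_pos (inv_pos.mpr hxy),
        abs_of_pos (by positivity : (0:ℝ) < (2 * n + 2) * τ ^ (2 * n + 1))]
    rw [setIntegral_congr_fun measurableSet_Ioo e, integral_const_mul, pow_ratio_eq_integral hx hy n]
    ring
  -- integrability of τ-sections
  have hintτ : ∀ p : ℝ × ℝ, 0 < p.1 → 0 < p.2 → Integrable (fun τ => Ψ p τ) μ := by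
    intro p hx hy
    set f : ℝ → ℝ := fun τ => Om p.1 * Om p.2 * ((p.1 * p.2) ^ (n + 1))⁻¹ * ((2 * n + 2 : ℝ) * τ ^ (2 * n + 1))
      with hf
    have hfc : Continuous f := continuous_const.mul (continuous_const.mul (continuous_pow _))
    have h1 : Integrable ((Ioo 0 (min p.1 p.2)).indicator f) volume :=
      (integrable_indicator_iff measurableSet_Ioo).mpr (hfc.integrableOn_Icc.mono_set Ioo_subset_Icc_self)
    refine (h1.restrict (s := Ioi 0)).congr ?_
    filter_upwards [ae_restrict_mem measurableSet_Ioi] with τ hτ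
    rw [hsecτ p τ]
    simp only [hf, Set.indicator_apply, mem_Ioo, mem_Iio, mem_Ioi.mp hτ, true_and]
  -- G is integrable on (0,∞)² × (0,∞)
  have hwm : Measurable fun p : ℝ × ℝ => (min p.1 p.2 / max p.1 p.2) ^ (n + 1) :=
    ((measurable_fst.min measurable_snd).div (measurable_fst.max measurable_snd)).pow_const _
  have hw01 : ∀ᵐ p ∂ μ.prod μ, 0 ≤ (min p.1 p.2 / max p.1 p.2) ^ (n + 1) ∧ (min p.1 p.2 / max p.1 p.2) ^ (n + 1) ≤ 1 := by
    filter_upwards [hquad] with p hp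
    have h := ratio_mem_Icc hp.1 hp.2
    exact ⟨pow_nonneg h.1 _, pow_le_one₀ h.1 h.2⟩
  have habs : Integrable (fun p : ℝ × ℝ => |Om p.1| * |Om p.2| * (min p.1 p.2 / max p.1 p.2) ^ (n + 1)) (μ.prod μ) :=
    integrable_prod_abs_mul_abs_mul hΩi hwm hw01
  have hGi : Integrable G ((μ.prod μ).prod μ) := by
    rw [integrable_prod_iff hGm.aestronglyMeasurable]
    constructor
    · filter_upwards [hquad] with p hp
      exact hintτ p hp.1 hp.2
    · refine habs.congr ?_
      filter_upwards [hquad] with p hp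
      exact (hnormτ p hp.1 hp.2).symm
  have hΨi : Integrable (Function.uncurry Ψ) ((μ.prod μ).prod μ) := by rw [hunc]; exact hGi
  -- p-sections for fixed τ > 0
  set g : ℝ → ℝ := fun y => Om y * (y ^ (n + 1))⁻¹ with hg
  have hsecp : ∀ τ, 0 < τ → ∀ p : ℝ × ℝ,
      Ψ p τ = (((2 * n + 2 : ℝ) * τ ^ (2 * n + 1)) * (Ioi τ).indicator g p.1) * (Ioi τ).indicator g p.2 := by
    intro τ hτ p
    simp only [hΨ, hG, hg, Set.indicator_apply, hE, mem_setOf_eq, mem_Ioi]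
    by_cases h1 : τ < p.1
    · by_cases h2 : τ < p.2
      · rw [if_pos ⟨h1, h2⟩, if_pos h1, if_pos h2, mul_pow, mul_inv]
        ring
      · rw [if_neg (fun h => h2 h.2), if_neg h2, mul_zero]
    · rw [if_neg (fun h => h1 h.1), if_neg h1, mul_zero, zero_mul]
  have hIoi : ∀ τ, 0 < τ → ∫ x, (Ioi τ).indicator g x ∂μ = ∫ y in Ioi τ, g y := by
    intro τ hτ
    rw [hμ, setIntegral_indicator measurableSet_Ioi, Ioi_inter_Ioi, sup_eq_right.mpr hτ.le]
  have hvalp : ∀ τ, 0 < τ → ∫ p, Ψ p τ ∂(μ.prod μ)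
      = ((2 * n + 2 : ℝ) * τ ^ (2 * n + 1)) * ((∫ y in Ioi τ, g y) * (∫ y in Ioi τ, g y)) := by
    intro τ hτ
    simp_rw [hsecp τ hτ]
    rw [integral_prod_mul (μ := μ) (ν := μ) (fun x => ((2 * n + 2 : ℝ) * τ ^ (2 * n + 1)) * (Ioi τ).indicator g x)
      ((Ioi τ).indicator g), integral_const_mul, hIoi τ hτ]
    ring
  -- assemble
  have hτ0 : ∀ᵐ τ ∂μ, 0 < τ := ae_restrict_mem measurableSet_Ioi
  refine ⟨?_, ?_⟩
  · have hI : Integrable (fun τ => ∫ p, Function.uncurry Ψ (p, τ) ∂(μ.prod μ)) μ := hΨi.integral_prod_right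
    refine hI.congr ?_
    filter_upwards [hτ0] with τ hτ
    exact hvalp τ hτ
  calc ∫ p, Om p.1 * Om p.2 * (min p.1 p.2 / max p.1 p.2) ^ (n + 1) ∂(μ.prod μ)
      = ∫ p, (∫ τ, Ψ p τ ∂μ) ∂(μ.prod μ) := by
        refine integral_congr_ae ?_
        filter_upwards [hquad] with p hp
        exact (hvalτ p hp.1 hp.2).symm
    _ = ∫ τ, (∫ p, Ψ p τ ∂(μ.prod μ)) ∂μ := integral_integral_swap hΨi
    _ = ∫ τ in Ioi (0:ℝ), ((2 * n + 2 : ℝ) * τ ^ (2 * n + 1))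
          * ((∫ y in Ioi τ, g y) * (∫ y in Ioi τ, g y)) := by
        refine integral_congr_ae ?_
        filter_upwards [hτ0] with τ hτ
        exact hvalp τ hτ

/-! ### The series under the integral sign on `(0,∞)²` -/

/-- A.e. on `(0,∞)²` we are off the diagonal. [folklore] -/
theorem ae_prod_Ioi_ne :
    ∀ᵐ p ∂((volume.restrict (Ioi (0:ℝ))).prod (volume.restrict (Ioi (0:ℝ)))), p.1 ≠ p.2 := by
  have hm : MeasurableSet {p : ℝ × ℝ | p.1 - p.2 ≠ 0} :=
    (measurable_fst.sub measurable_snd) (measurableSet_singleton (0:ℝ)).compl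
  have h : ∀ᵐ p ∂((volume.restrict (Ioi (0:ℝ))).prod (volume.restrict (Ioi (0:ℝ)))), p.1 - p.2 ≠ 0 := by
    rw [Measure.ae_prod_iff_ae_ae hm]
    refine ae_of_all _ fun x => ?_
    filter_upwards [(Set.countable_singleton x).ae_notMem (volume.restrict (Ioi (0:ℝ)))] with y hy
    exact fun h => hy (by rw [mem_singleton_iff]; linarith)
  filter_upwards [h] with p hp
  exact fun h => hp (by rw [h, sub_self])

/-- **The signed kernel integrand `Ω(x)Ω(y) log((x+y)/|x−y|)` is integrable on `(0,∞)²`**: the `y`-sections are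
integrable and `x ↦ |Ω(x)|∫₀^∞|Ω(y)| log((x+y)/|x−y|) dy ≤ (log 5·‖Ω‖₁ + (1+log 5)C)·|Ω(x)|`
(`SheetHalfLineVelocityKernel`). [folklore] -/
theorem integrable_prod_mul_logKernel {Om : ℝ → ℝ} {C : ℝ} (hc : Continuous Om)
    (hC : ∀ y, |Om y| ≤ C / (1 + y ^ 2)) :
    Integrable (fun p : ℝ × ℝ => Om p.1 * Om p.2 * Real.log ((p.1 + p.2) / |p.1 - p.2|))
      ((volume.restrict (Ioi (0:ℝ))).prod (volume.restrict (Ioi (0:ℝ)))) := by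
  set μ : Measure ℝ := volume.restrict (Ioi (0:ℝ)) with hμ
  have hΩm : Measurable Om := hc.measurable
  have hΩi : Integrable Om := integrable_of_env hc hC
  have hFm : Measurable (fun p : ℝ × ℝ => Om p.1 * Om p.2 * Real.log ((p.1 + p.2) / |p.1 - p.2|)) :=
    ((hΩm.comp measurable_fst).mul (hΩm.comp measurable_snd)).mul
      (((measurable_fst.add measurable_snd).div ((measurable_fst.sub measurable_snd).abs)).log)
  have hx0 : ∀ᵐ x ∂μ, 0 < x := ae_restrict_mem measurableSet_Ioi
  -- norm of the y-section at x > 0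
  have hnorm : ∀ x, 0 < x → ∀ y ∈ Ioi (0:ℝ),
      ‖Om x * Om y * Real.log ((x + y) / |x - y|)‖ = |Om x| * (|Om y| * Real.log ((x + y) / |x - y|)) := by
    intro x hx y hy
    rw [Real.norm_eq_abs, abs_mul, abs_mul, abs_of_nonneg (logKernel_nonneg hx.le (le_of_lt hy)), mul_assoc]
  rw [integrable_prod_iff hFm.aestronglyMeasurable]
  constructor
  · filter_upwards [hx0] with x hx
    have hI := (integrableOn_abs_mul_logKernel hc hC hx).const_mul (|Om x|)
    refine Integrable.mono' hI (hFm.comp measurable_prodMk_left).aestronglyMeasurable ?_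
    filter_upwards [ae_restrict_mem measurableSet_Ioi] with y hy
    exact le_of_eq (hnorm x hx y hy)
  · set W : ℝ := Real.log 5 * (∫ y, |Om y|) + (1 + Real.log 5) * C with hW
    refine Integrable.mono' ((hΩi.abs.restrict (s := Ioi 0)).mul_const W)
      hFm.aestronglyMeasurable.norm.integral_prod_right' ?_
    filter_upwards [hx0] with x hx
    rw [Real.norm_of_nonneg (integral_nonneg fun _ => norm_nonneg _), hμ,
      setIntegral_congr_fun measurableSet_Ioi (hnorm x hx), integral_const_mul]
    exact mul_le_mul_of_nonneg_left (integral_abs_mul_logKernel_le hc hC hx) (abs_nonneg _)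

/-- **THE SERIES UNDER THE INTEGRAL: `HasSum (k ↦ ∬ (2/(2k+1)) Ω(x)Ω(y) q^{2k+1}) (∬ Ω(x)Ω(y) log((x+y)/|x−y|))`** on
`(0,∞)²` (dominated convergence for series; majorant `|Ω(x)||Ω(y)| log((x+y)/|x−y|)`). [folklore] -/
theorem hasSum_integral_prod_logKernel {Om : ℝ → ℝ} {C : ℝ} (hc : Continuous Om)
    (hC : ∀ y, |Om y| ≤ C / (1 + y ^ 2)) :
    HasSum (fun k : ℕ => ∫ p, (2:ℝ) * (1 / (2 * k + 1)) * (Om p.1 * Om p.2 * (min p.1 p.2 / max p.1 p.2) ^ (2 * k + 1))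
        ∂((volume.restrict (Ioi (0:ℝ))).prod (volume.restrict (Ioi (0:ℝ)))))
      (∫ p, Om p.1 * Om p.2 * Real.log ((p.1 + p.2) / |p.1 - p.2|)
        ∂((volume.restrict (Ioi (0:ℝ))).prod (volume.restrict (Ioi (0:ℝ))))) := by
  set μ : Measure ℝ := volume.restrict (Ioi (0:ℝ)) with hμ
  have hΩm : Measurable Om := hc.measurable
  have hquad : ∀ᵐ p ∂ μ.prod μ, 0 < p.1 ∧ 0 < p.2 := ae_prod_Ioi_pos
  have hne : ∀ᵐ p ∂ μ.prod μ, p.1 ≠ p.2 := ae_prod_Ioi_ne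
  have hqm : Measurable fun p : ℝ × ℝ => min p.1 p.2 / max p.1 p.2 :=
    (measurable_fst.min measurable_snd).div (measurable_fst.max measurable_snd)
  have hGi := integrable_prod_mul_logKernel hc hC
  refine hasSum_integral_of_dominated_convergence
    (fun k p => (2:ℝ) * (1 / (2 * k + 1)) * (|Om p.1| * |Om p.2| * (min p.1 p.2 / max p.1 p.2) ^ (2 * k + 1)))
    (fun k => ?_) (fun k => ?_) ?_ ?_ ?_
  · exact (measurable_const.mul (((hΩm.comp measurable_fst).mul (hΩm.comp measurable_snd)).mul
      (hqm.pow_const _))).aestronglyMeasurable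
  · filter_upwards [hquad] with p hp
    have hq := ratio_mem_Icc hp.1 hp.2
    have hc0 : (0:ℝ) ≤ 2 * (1 / (2 * k + 1)) := by positivity
    rw [Real.norm_eq_abs, abs_mul, abs_of_nonneg hc0, abs_mul, abs_mul, abs_of_nonneg (pow_nonneg hq.1 _)]
  · filter_upwards [hquad, hne] with p hp hpne
    have h := (hasSum_logKernel hp.1 hp.2 hpne).mul_left (|Om p.1| * |Om p.2|)
    refine h.summable.congr fun k => ?_
    ring
  · refine hGi.norm.congr ?_
    filter_upwards [hquad, hne] with p hp hpne
    have h := (hasSum_logKernel hp.1 hp.2 hpne).mul_left (|Om p.1| * |Om p.2|)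
    have e : (fun k : ℕ => |Om p.1| * |Om p.2| * ((2:ℝ) * (1 / (2 * k + 1)) * (min p.1 p.2 / max p.1 p.2) ^ (2 * k + 1)))
        = fun k : ℕ => (2:ℝ) * (1 / (2 * k + 1)) * (|Om p.1| * |Om p.2| * (min p.1 p.2 / max p.1 p.2) ^ (2 * k + 1)) :=
      funext fun k => by ring
    rw [e] at h
    rw [h.tsum_eq, Real.norm_eq_abs, abs_mul, abs_mul,
      abs_of_nonneg (logKernel_nonneg hp.1.le hp.2.le)]
  · filter_upwards [hquad, hne] with p hp hpne
    have h := (hasSum_logKernel hp.1 hp.2 hpne).mul_left (Om p.1 * Om p.2)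
    have e : (fun k : ℕ => Om p.1 * Om p.2 * ((2:ℝ) * (1 / (2 * k + 1)) * (min p.1 p.2 / max p.1 p.2) ^ (2 * k + 1)))
        = fun k : ℕ => (2:ℝ) * (1 / (2 * k + 1)) * (Om p.1 * Om p.2 * (min p.1 p.2 / max p.1 p.2) ^ (2 * k + 1)) :=
      funext fun k => by ring
    rw [e] at h
    exact h

end SheetHalfLine
end Summit.NavierStokesRegularity.OSWSelfSimilar
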